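import Literature.Barriers.RiemannHypothesis.JensenPolynomialsLogConcaveKernel
import HarnessLib

/-!
# First-level log-concavity of `K(√t)` does not give Csordas' double Turán inequalities
# (companion to the barrier `JensenPolynomialsLogConcaveKernel`)

Barrier catalogue `Literature/Barriers/RiemannHypothesis/` (D-0021); continuation of
`JensenPolynomialsLogConcaveKernel.lean` (same technique class: admissible kernels in the sense of
Dimitrov–Lucas, Definition 1, with `log K(√t)` strictly concave), kept in a separate module only for
file size. That file proves: the class certifies ROW 2 of the Jensen grid (all Turán inequalities) and
NOT cell `(3,0)` (Dimitrov–Lucas 2011, Theorem 1, false as stated). This file adds the analogous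
statement on the ITERATED-Turán axis.

Csordas' DOUBLE TURÁN INEQUALITIES. With `γ_k = k! b_k/(2k)!`, `b_k = ∫₀^∞ t^{2k}K(t) dt`
(`= kernelTaylorSeq K k`), `T_k = γ_k² − γ_{k−1}γ_{k+1}` and `E_k = T_k² − T_{k−1}T_{k+1}`, Csordas
(Comput. Methods Funct. Theory 15 (2015), §4, before Open Problem 4.14; = Problem 3 of his ISAAC 2001
survey) records: a necessary condition for RH is `E_k ≥ 0` for `k = 2, 3, …` (for `K = Φ`; Craven–Csordas
2002: every `φ ∈ 𝓛-𝓟⁺` satisfies the double Turán inequalities), and a KERNEL-SIDE route to them in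
print is a SECOND-LEVEL concavity condition — with `s(t) = K(√t)` and the first Laguerre expression
`f = s′² − s s″` (positive once `log s` is concave), the condition `(log f)″ < 0` on `(0,∞)`
(Csordas–Dimitrov 2000, Problem 3.3 = Csordas 2015, Open Problem 4.14), which by Csordas–Dimitrov 2000,
Theorem 2.4 "implies the double Turán inequalities" (so reported in Csordas 2015 §4 and in the 2001 survey;
the tree has not examined that proof — acquisition request acq-11869). Planat–Solé (arXiv:2608.19160,
19 Aug 2026, Theorem 1.1) PROVE the second-level condition for `Φ` (two computer-assisted proofs) and
deduce `E_k ≥ 0` for `Ξ` through Theorem 2.4 (their §7).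

This file places that route relative to the barrier: the second-level input is NOT redundant in the
technique class — admissibility (i)–(v) + FIRST-level log-concavity of `K(√t)` (both shapes) do NOT
imply `E_2 ≥ 0` (`exists_admissible_doubleTuran_neg`, `not_doubleTuran_of_logConcaveSqrt`), although they
do imply every `T_k > 0` (`turanDiff_pos_of_logConcaveSqrt`, the positive side). The quartic family
`K_ε` of the previous sections does not see this (its quadratic `q` has `E_2(q) = 1216843607/10¹⁵ > 0`,
`doubleTuran_qSeq_two`); the witness is the Gaussian-times-SEXTIC family
`K₃,ε(t) = e^{−t²−εt⁴}(1 + t²/2 + t⁴/16 + t⁶/96)`: at `ε = 0`, EXACTLY, `γ_m = (√π/2)4^{−m}μ(m)` with the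
CUBIC `μ(m) = 1 + (m+½)/2 + (m+½)(m+3/2)/16 + (m+½)(m+3/2)(m+5/2)/96`
(`μ(0..4) = 337/256, 543/256, 821/256, 1187/256, 1657/256`), `T_1, T_2, T_3 = 4543, 7375, 12143 (/2¹⁴)`
and `E_2(μ) = −48439/2²⁴`, i.e. `E_2(γ(K₃,₀)) = −48439·π²/2⁴⁴ < 0` (`doubleTuran_K3_zero_two`); the
class properties hold for every `ε ≥ 0` (`P₃′² − P₃P₃″ = 1/8 + s²/128 + s³/384 + s⁴/3072 > 0`), `K₃,₀`
misses only (v), and `ε > 0` is reached by dominated convergence of `b₀, …, b₄`. Nothing here bears on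
the truth of Csordas–Dimitrov's Theorem 2.4 or of Planat–Solé's Theorem 1.1, nor on `Ξ`.

Contents: `turanDiff`, `doubleTuran` (Csordas' `T_k`, `E_k`), `turanDiff_kernelTaylorSeq_succ`
(`T_k(γ) = c_k·T_k(b)` against Dimitrov–Lucas' moment form `dlT`), `turanDiff_pos_of_logConcaveSqrt`
(the positive side in Csordas' normalisation), `doubleTuran_qSeq_two` (the quartic family has
`E_2 > 0`); namespace `DoubleTuranWitness`: `K3`, `K3_admissible` ((i)–(v), entire, `δ = 1`, (8) both
shapes, all `ε > 0`), `kernelTaylorSeq_K3_zero`, `doubleTuran_mu3_two`, `doubleTuran_K3_zero_two`,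
`exists_pos_doubleTuran_K3_two_neg`; main statements `exists_admissible_doubleTuran_neg`,
`not_doubleTuran_of_logConcaveSqrt`. Four elementary lemmas of the sibling file (Gaussian moments,
`(Qe^g)′`, the `O(e^{−t³})` bound, the half-integer Legendre identity) are private there and are
re-proved here verbatim as private lemmas.

## References

* [Csordas2015] G. Csordas, *Fourier transforms of positive definite kernels and the Riemann
  ξ-function*, Comput. Methods Funct. Theory 15 (2015) 373–391 (arXiv:1309.0055, read): §4, (4.4)–(4.5)
  (`γ_k = k! b_k/(2k)!`, `T_k`), the paragraph before Open Problem 4.14 (`E_k`, RH-necessity, "[14,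
  Theorem 2.4]"), Open Problem 4.14 (second-level concavity).
* [CsordasDimitrov2000] G. Csordas, D. K. Dimitrov, *Conjectures and theorems in the theory of entire
  functions*, Numer. Algorithms 25 (2000) 109–122: Theorem 2.4 and Problem 3.3 — NOT held (acq-11869),
  cited through Csordas2015 §4 and Csordas' ISAAC 2001 survey (Problems 3–4, "[12], Theorem 2.4"); its
  proof is not examined here.
* [PlanatSole2026] M. Planat, P. Solé, *Second-Level Concavity of the Riemann Ξ Kernel*,
  arXiv:2608.19160 (19 Aug 2026, read): Theorem 1.1, §7.
* [DimitrovLucas2011] D. K. Dimitrov, F. R. Lucas, Proc. AMS 139 (2011) 1013–1022: Definition 1, (6), (8).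
* [Varga1990] R. S. Varga, *Scientific Computation on Mathematical Problems and Conjectures*, SIAM 1990,
  §3.3 (3.27)–(3.28).
* Origin: rh-jensen-barrier-1 g5 (2026-08-26), erratum watch on Dimitrov–Lucas' Theorem 1 → citing work
  Planat–Solé 2026 → Csordas–Dimitrov's second-level criterion; numerics (the cubic-polynomial scan) in
  the seat folder `scratch/`.
-/

noncomputable section

open Polynomial Real Set MeasureTheory Filter
open scoped Nat Topology

namespace Literature.Barriers.RiemannHypothesis

open Literature.NumberTheory.LFunctions Literature.Analysis.Complex.PolyaSchur
open LogConcaveKernel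

/-! ## Csordas' `T_k` and `E_k` -/

/-- Csordas' Turán differences of a sequence `γ`: `T_k(γ) = γ_k² − γ_{k−1}γ_{k+1}` (`k ≥ 1`; `k − 1` is
`ℕ`-subtraction and only `k ≥ 1` is meaningful). For `γ_k = k! b_k/(2k)!`, `b_k = ∫₀^∞ t^{2k}K`, these
are the `T_k` of Csordas 2015 (4.5) (`= c_k·T_k(b)` with Dimitrov–Lucas' moment form `dlT`,
`turanDiff_kernelTaylorSeq_succ`). [cite: Csordas2015, §4 (4.4)–(4.5)] -/
def turanDiff (γ : ℕ → ℝ) (k : ℕ) : ℝ := γ k ^ 2 - γ (k - 1) * γ (k + 1)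

/-- Csordas' DOUBLE TURÁN expressions `E_k(γ) = T_k² − T_{k−1}T_{k+1}` (`k ≥ 2`): "a necessary
condition for the Riemann Hypothesis to hold is that the double Turán inequalities should hold; i.e.,
`E_k ≥ 0` for `k = 2, 3, 4, …`" (for `γ_k = k! b_k/(2k)!`, `b_k = ∫₀^∞ t^{2k}Φ(t) dt`).
[cite: Csordas2015, §4, paragraph before Open Problem 4.14] -/
def doubleTuran (γ : ℕ → ℝ) (k : ℕ) : ℝ :=
  turanDiff γ k ^ 2 - turanDiff γ (k - 1) * turanDiff γ (k + 1)

/-- `E_2` is homogeneous: `E_2(c r^m γ_m) = c⁴ r⁸ E_2(γ)` — its SIGN does not see geometric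
renormalisations of `γ` (such as `γ_k = k! b_k/(2k)!` versus `(√π/2)4^{−k}μ(k)`, or half-line versus
full-line moments). [cite: Csordas2015, §4 (4.4)] -/
theorem doubleTuran_two_const_mul_pow_mul (c r : ℝ) (γ : ℕ → ℝ) :
    doubleTuran (fun m => c * r ^ m * γ m) 2 = c ^ 4 * r ^ 8 * doubleTuran γ 2 := by
  simp only [doubleTuran, turanDiff]
  norm_num
  ring

/-- `γ ↦ E_2(γ)` is continuous (a polynomial in `γ₀, …, γ₄`). [folklore] -/
private theorem continuous_doubleTuran_two : Continuous fun γ : ℕ → ℝ => doubleTuran γ 2 := by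
  unfold doubleTuran turanDiff
  fun_prop

/-- The Turán differences of the Taylor sequence `γ_k = k! b_k/(2k)!` against Dimitrov–Lucas' moment
form (6): `T_{m+1}(γ) = ((m+1)!/(2m+2)!)²/(2m+3) · [(2m+3)b_{m+1}² − (2m+1)b_mb_{m+2}]` (p. 1015–1016:
`T_k = c_kT_k(b)`, `c_k > 0`). [cite: DimitrovLucas2011, (6) and p. 1015–1016] -/
theorem turanDiff_kernelTaylorSeq_succ (K : ℝ → ℝ) (m : ℕ) :
    turanDiff (kernelTaylorSeq K) (m + 1) =
      (((m + 1)! : ℝ) / ((2 * (m + 1))! : ℝ)) ^ 2 / (2 * (m : ℝ) + 3) * dlT (kernelMoment K) (m + 1) := by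
  have hf1 : ((m + 1)! : ℝ) = ((m : ℝ) + 1) * (m ! : ℝ) := by
    rw [Nat.factorial_succ]; push_cast; ring
  have hf2 : ((m + 1 + 1)! : ℝ) = ((m : ℝ) + 2) * ((m : ℝ) + 1) * (m ! : ℝ) := by
    rw [Nat.factorial_succ, Nat.factorial_succ]; push_cast; ring
  have hg1 : ((2 * (m + 1))! : ℝ) = (2 * (m : ℝ) + 2) * (2 * (m : ℝ) + 1) * ((2 * m)! : ℝ) := by
    rw [show 2 * (m + 1) = (2 * m + 1) + 1 by ring, Nat.factorial_succ, Nat.factorial_succ]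
    push_cast; ring
  have hg2 : ((2 * (m + 1 + 1))! : ℝ) = (2 * (m : ℝ) + 4) * (2 * (m : ℝ) + 3) * ((2 * (m : ℝ) + 2) *
      (2 * (m : ℝ) + 1) * ((2 * m)! : ℝ)) := by
    rw [show 2 * (m + 1 + 1) = (((2 * m + 1) + 1) + 1) + 1 by ring, Nat.factorial_succ, Nat.factorial_succ,
      Nat.factorial_succ, Nat.factorial_succ]
    push_cast; ring
  have hn0 : ((2 * m)! : ℝ) ≠ 0 := by positivity
  have hn0' : (m ! : ℝ) ≠ 0 := by positivity
  have h3 : (2 * (m : ℝ) + 3) ≠ 0 := by positivity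
  have h1 : (2 * (m : ℝ) + 1) ≠ 0 := by positivity
  have h2 : (2 * (m : ℝ) + 2) ≠ 0 := by positivity
  have h4 : (2 * (m : ℝ) + 4) ≠ 0 := by positivity
  simp only [turanDiff, dlT, kernelTaylorSeq, Nat.add_sub_cancel, Nat.cast_add, Nat.cast_one]
  rw [hf1, hf2, hg1, hg2]
  field_simp
  ring

/-- **In the log-concave-`√t` class the Turán inequalities hold in Csordas' normalisation**: `T_k(γ) > 0`
for every `k ≥ 1`, `γ_k = k! b_k(K)/(2k)!` (the positive side `dlT_pos_of_logConcaveSqrt`, i.e.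
Csordas–Varga's moment inequalities (3.27)). [cite: Csordas2015, §4 (4.5)] [cite: Varga1990, §3.3 (3.27)–(3.28)] -/
theorem turanDiff_pos_of_logConcaveSqrt {K : ℝ → ℝ} (hK : ContDiff ℝ 2 K) (hint : Integrable K)
    (hpos : ∀ t, 0 < K t) (hdec : ∃ δ : ℝ, 0 < δ ∧ K =O[atTop] fun t => Real.exp (-|t| ^ (2 + δ)))
    (hconc : ∀ s, 0 < s → deriv^[2] (fun s => Real.log (K (Real.sqrt s))) s < 0) {k : ℕ}
    (hk : 1 ≤ k) : 0 < turanDiff (kernelTaylorSeq K) k := by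
  obtain ⟨m, rfl⟩ := Nat.exists_eq_add_of_le' hk
  rw [turanDiff_kernelTaylorSeq_succ]
  have h := dlT_pos_of_logConcaveSqrt hK hint hpos hdec hconc (k := m + 1) le_add_self
  positivity

/-- For the QUARTIC family `K_ε` of `JensenPolynomialsLogConcaveKernel.lean` the first double Turán expression of the
quadratic `q` is POSITIVE, `E_2(q) = 1216843607/10¹⁵` (exact: Csordas' `E_2` for that Taylor sequence),
so those kernels do not bear on `E_2`; a sextic polynomial factor is used below.
[cite: Csordas2015, §4, paragraph before Open Problem 4.14] -/
theorem doubleTuran_qSeq_two : doubleTuran qSeq 2 = 1216843607 / 10 ^ 15 := by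
  norm_num [doubleTuran, turanDiff, qSeq]

namespace DoubleTuranWitness

/-! ### Four elementary lemmas of `JensenPolynomialsLogConcaveKernel.lean` (private there) -/

/-- Gaussian moments: `∫₀^∞ e^{-t²} t^{2m} dt = Γ(m + ½)/2`. [folklore] -/
private theorem integral_exp_neg_sq_mul_pow (m : ℕ) :
    ∫ t in Ioi (0 : ℝ), Real.exp (-t ^ 2) * t ^ (2 * m) = Real.Gamma (m + 1 / 2) / 2 := by
  have h := integral_rpow_mul_exp_neg_rpow (p := 2) (q := ((2 * m : ℕ) : ℝ)) two_pos
    (by have : (0 : ℝ) ≤ ((2 * m : ℕ) : ℝ) := Nat.cast_nonneg _; linarith)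
  have e : (fun x : ℝ => x ^ ((2 * m : ℕ) : ℝ) * Real.exp (-x ^ (2 : ℝ))) =
      fun x : ℝ => Real.exp (-x ^ 2) * x ^ (2 * m) := by
    funext x
    rw [Real.rpow_natCast, Real.rpow_two, mul_comm]
  rw [e] at h
  rw [h]
  have e2 : (((2 * m : ℕ) : ℝ) + 1) / 2 = (m : ℝ) + 1 / 2 := by push_cast; ring
  rw [e2]
  ring

/-- Integrability of the Gaussian moments on `(0, ∞)`. [folklore] -/
private theorem integrableOn_exp_neg_sq_mul_pow (m : ℕ) :
    IntegrableOn (fun t : ℝ => Real.exp (-t ^ 2) * t ^ (2 * m)) (Ioi 0) := by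
  have h := integrableOn_rpow_mul_exp_neg_rpow (s := ((2 * m : ℕ) : ℝ)) (p := 2)
    (by have : (0 : ℝ) ≤ ((2 * m : ℕ) : ℝ) := Nat.cast_nonneg _; linarith) (by norm_num)
  have e : (fun x : ℝ => x ^ ((2 * m : ℕ) : ℝ) * Real.exp (-x ^ (2 : ℝ))) =
      fun x : ℝ => Real.exp (-x ^ 2) * x ^ (2 * m) := by
    funext x
    rw [Real.rpow_natCast, Real.rpow_two, mul_comm]
  rwa [e] at h

/-- `(Q·e^{g})′ = (Q′ + Q g′)·e^{g}` for polynomials `Q, g`. [folklore] -/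
private theorem hasDerivAt_eval_mul_exp (Q g : ℝ[X]) (t : ℝ) :
    HasDerivAt (fun t : ℝ => Q.eval t * Real.exp (g.eval t))
      ((derivative Q + Q * derivative g).eval t * Real.exp (g.eval t)) t := by
  have h := (Q.hasDerivAt t).fun_mul (g.hasDerivAt t).exp
  refine h.congr_deriv ?_
  simp only [eval_add, eval_mul]
  ring

/-- For `ε > 0`, `Q(t)·e^{-t²-εt⁴} = O(e^{-t³})` as `t → +∞`, for every polynomial `Q`. [folklore] -/
private theorem eval_mul_exp_isBigO {ε : ℝ} (hε : 0 < ε) (Q : ℝ[X]) :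
    (fun t : ℝ => Q.eval t * Real.exp ((gPoly ε).eval t)) =O[atTop] fun t : ℝ => Real.exp (-t ^ 3) := by
  set d := Q.natDegree with hd
  have hQ : (fun t : ℝ => Q.eval t) =O[atTop] fun t : ℝ => (X ^ d : ℝ[X]).eval t :=
    Polynomial.isBigO_atTop_of_degree_le Q (X ^ d) (by rw [degree_X_pow]; exact degree_le_natDegree)
  obtain ⟨C, hC0, hC⟩ := hQ.exists_pos
  rw [Asymptotics.IsBigOWith_def] at hC
  refine Asymptotics.IsBigO.of_bound (C * d !) ?_
  filter_upwards [hC, eventually_ge_atTop (max 1 ε⁻¹)] with t hQt ht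
  have ht1 : 1 ≤ t := le_trans (le_max_left _ _) ht
  have htε : ε⁻¹ ≤ t := le_trans (le_max_right _ _) ht
  have ht0 : 0 ≤ t := by linarith
  simp only [eval_pow, eval_X, Real.norm_eq_abs, abs_of_nonneg (pow_nonneg ht0 _)] at hQt
  rw [Real.norm_eq_abs, Real.norm_eq_abs, abs_mul, Real.abs_exp, Real.abs_exp]
  have hεt : 1 ≤ ε * t := by
    have := mul_le_mul_of_nonneg_left htε hε.le
    rwa [mul_inv_cancel₀ hε.ne'] at this
  have hg : (gPoly ε).eval t + t ≤ -t ^ 3 := by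
    simp only [gPoly, eval_sub, eval_neg, eval_pow, eval_X, eval_mul, eval_C]
    have h1 : t ^ 3 ≤ ε * t ^ 4 := by nlinarith [pow_nonneg ht0 3]
    nlinarith
  have hpow : t ^ d ≤ (d ! : ℝ) * Real.exp t := pow_le_factorial_mul_exp ht0 d
  calc |Q.eval t| * Real.exp ((gPoly ε).eval t)
      ≤ C * t ^ d * Real.exp ((gPoly ε).eval t) := by gcongr
    _ ≤ C * ((d ! : ℝ) * Real.exp t) * Real.exp ((gPoly ε).eval t) := by gcongr
    _ = C * (d ! : ℝ) * Real.exp ((gPoly ε).eval t + t) := by rw [Real.exp_add]; ring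
    _ ≤ C * (d ! : ℝ) * Real.exp (-t ^ 3) := by gcongr

/-- `(m!/(2m)!)·Γ(m + ½)/2 = (√π/2)·4^{-m}` (Legendre duplication at half-integers). [folklore] -/
private theorem factorial_div_mul_Gamma_half (m : ℕ) :
    (m ! : ℝ) / ((2 * m)! : ℝ) * (Real.Gamma (m + 1 / 2) / 2) = Real.sqrt π / 2 * (1 / 4) ^ m := by
  induction m with
  | zero => rw [Nat.cast_zero, zero_add, Real.Gamma_one_half_eq]; simp
  | succ m ih =>
    have hpos : (0 : ℝ) < m + 1 / 2 := by positivity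
    have hG : Real.Gamma (((m + 1 : ℕ) : ℝ) + 1 / 2) = ((m : ℝ) + 1 / 2) * Real.Gamma (m + 1 / 2) := by
      rw [Nat.cast_succ, show (m : ℝ) + 1 + 1 / 2 = ((m : ℝ) + 1 / 2) + 1 by ring,
        Real.Gamma_add_one hpos.ne']
    have hf1 : ((m + 1)! : ℝ) = ((m : ℝ) + 1) * (m ! : ℝ) := by
      rw [Nat.factorial_succ]; push_cast; ring
    have hf2 : ((2 * (m + 1))! : ℝ) = (2 * (m : ℝ) + 2) * (2 * (m : ℝ) + 1) * ((2 * m)! : ℝ) := by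
      rw [show 2 * (m + 1) = (2 * m + 1) + 1 by ring, Nat.factorial_succ, Nat.factorial_succ]
      push_cast; ring
    have hm0 : ((2 * m)! : ℝ) ≠ 0 := by positivity
    have h21 : (2 * (m : ℝ) + 1) ≠ 0 := by positivity
    have h22 : (2 * (m : ℝ) + 2) ≠ 0 := by positivity
    calc ((m + 1)! : ℝ) / ((2 * (m + 1))! : ℝ) * (Real.Gamma (((m + 1 : ℕ) : ℝ) + 1 / 2) / 2)
        = (((m : ℝ) + 1) * ((m : ℝ) + 1 / 2) / ((2 * (m : ℝ) + 2) * (2 * (m : ℝ) + 1))) *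
            ((m ! : ℝ) / ((2 * m)! : ℝ) * (Real.Gamma (m + 1 / 2) / 2)) := by
          rw [hG, hf1, hf2]
          field_simp
      _ = Real.sqrt π / 2 * (1 / 4) ^ (m + 1) := by
          rw [ih, pow_succ]
          field_simp
          ring

/-! ### The witness family `K₃,ε(t) = exp(−t² − εt⁴)(1 + t²/2 + t⁴/16 + t⁶/96)` -/

/-- The cubic factor `P₃(s) = 1 + s/2 + s²/16 + s³/96` (variable `s = t²`). [folklore] -/
def P3 (s : ℝ) : ℝ := 1 + s / 2 + s ^ 2 / 16 + s ^ 3 / 96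

/-- `P₃′(s) = 1/2 + s/8 + s²/32`. [folklore] -/
def P3' (s : ℝ) : ℝ := 1 / 2 + s / 8 + s ^ 2 / 32

/-- `P₃″(s) = 1/8 + s/16`. [folklore] -/
def P3'' (s : ℝ) : ℝ := 1 / 8 + s / 16

/-- The witness kernels `K₃,ε(t) = exp(−t² − εt⁴)·P₃(t²)` (`ε ≥ 0`): even, positive, entire, strictly
decreasing on `(0,∞)`, `log K₃,ε(√s) = −s − εs² + log P₃(s)` strictly concave on `(0,∞)`; admissible in
the sense of Dimitrov–Lucas, Definition 1, for `ε > 0`. [cite: DimitrovLucas2011, Definition 1] -/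
def K3 (ε : ℝ) (t : ℝ) : ℝ := Real.exp (-t ^ 2 - ε * t ^ 4) * P3 (t ^ 2)

/-- `P₃(s) ≥ 1` for `s ≥ 0`. [folklore] -/
private theorem one_le_P3 {s : ℝ} (hs : 0 ≤ s) : 1 ≤ P3 s := by
  rw [P3]
  have : 0 ≤ s / 2 + s ^ 2 / 16 + s ^ 3 / 96 := by positivity
  linarith

/-- `P₃(s) > 0` for `s ≥ 0`. [folklore] -/
private theorem P3_pos {s : ℝ} (hs : 0 ≤ s) : 0 < P3 s := lt_of_lt_of_le one_pos (one_le_P3 hs)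

/-- `P₃` has derivative `P₃′`. [folklore] -/
private theorem hasDerivAt_P3 (s : ℝ) : HasDerivAt P3 (P3' s) s := by
  have h := ((((hasDerivAt_id' s).div_const (2 : ℝ)).const_add (1 : ℝ)).fun_add
    ((hasDerivAt_pow 2 s).div_const (16 : ℝ))).fun_add ((hasDerivAt_pow 3 s).div_const (96 : ℝ))
  refine h.congr_deriv ?_
  simp only [P3', Nat.cast_ofNat]
  ring

/-- `P₃′` has derivative `P₃″`. [folklore] -/
private theorem hasDerivAt_P3' (s : ℝ) : HasDerivAt P3' (P3'' s) s := by
  have h := (((hasDerivAt_id' s).div_const (8 : ℝ)).const_add (1 / 2 : ℝ)).fun_add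
    ((hasDerivAt_pow 2 s).div_const (32 : ℝ))
  refine h.congr_deriv ?_
  simp only [P3'', Nat.cast_ofNat]
  ring

/-- The first Laguerre expression of `P₃`: `P₃′² − P₃P₃″ = 1/8 + s²/128 + s³/384 + s⁴/3072` (all
coefficients `≥ 0`: `(1/2)² > 2·(1/16)` and `(1/2)(1/16) = 3·(1/96)`). [folklore] -/
private theorem laguerre_P3 (s : ℝ) :
    P3' s ^ 2 - P3 s * P3'' s = 1 / 8 + s ^ 2 / 128 + s ^ 3 / 384 + s ^ 4 / 3072 := by
  rw [P3, P3', P3'']; ring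

/-- `P₃′² − P₃P₃″ > 0` for `s ≥ 0`. [folklore] -/
private theorem laguerre_P3_pos {s : ℝ} (hs : 0 ≤ s) : 0 < P3' s ^ 2 - P3 s * P3'' s := by
  rw [laguerre_P3]; positivity

/-- `K₃,ε > 0` (Dimitrov–Lucas (i)). [cite: DimitrovLucas2011, Definition 1 (i)] -/
theorem K3_pos (ε t : ℝ) : 0 < K3 ε t := mul_pos (Real.exp_pos _) (P3_pos (sq_nonneg t))

/-- `K₃,ε` is even ((iii)). [cite: DimitrovLucas2011, Definition 1 (iii)] -/
theorem K3_even (ε t : ℝ) : K3 ε (-t) = K3 ε t := by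
  simp only [K3, even_two.neg_pow, show (-t) ^ 4 = t ^ 4 by ring]

/-- The derivative `K₃,ε′(t) = −2t·e^{−t²−εt⁴}·[(1 + 2εt²)P₃(t²) − P₃′(t²)]`. [folklore] -/
def dK3 (ε t : ℝ) : ℝ :=
  -(2 * t * Real.exp (-t ^ 2 - ε * t ^ 4) * ((1 + 2 * ε * t ^ 2) * P3 (t ^ 2) - P3' (t ^ 2)))

/-- The exponent `−t² − εt⁴` has derivative `−2t − 4εt³`. [folklore] -/
private theorem hasDerivAt_exponent3 (ε t : ℝ) :
    HasDerivAt (fun t : ℝ => -t ^ 2 - ε * t ^ 4) (-(2 * t) - ε * (4 * t ^ 3)) t := by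
  have h := ((hasDerivAt_pow 2 t).fun_neg).fun_sub ((hasDerivAt_pow 4 t).const_mul ε)
  refine h.congr_deriv ?_
  simp

/-- `K₃,ε` has derivative `dK3 ε`. [folklore] -/
private theorem hasDerivAt_K3 (ε t : ℝ) : HasDerivAt (K3 ε) (dK3 ε t) t := by
  have h2 : HasDerivAt (fun t : ℝ => P3 (t ^ 2)) (P3' (t ^ 2) * (2 * t)) t := by
    have h := (hasDerivAt_P3 (t ^ 2)).comp t (hasDerivAt_pow 2 t)
    refine h.congr_deriv ?_
    simp
  have h := ((hasDerivAt_exponent3 ε t).exp).fun_mul h2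
  refine h.congr_deriv ?_
  rw [dK3]
  ring

/-- `deriv K₃,ε = dK3 ε`. [folklore] -/
private theorem deriv_K3 (ε : ℝ) : deriv (K3 ε) = dK3 ε := funext fun t => (hasDerivAt_K3 ε t).deriv

/-- `K₃,ε` is smooth. [folklore] -/
private theorem contDiff_K3 (ε : ℝ) {n : WithTop ℕ∞} : ContDiff ℝ n (K3 ε) := by
  unfold K3 P3
  fun_prop

/-- `K₃,ε` is continuous. [folklore] -/
private theorem continuous_K3 (ε : ℝ) : Continuous (K3 ε) := (contDiff_K3 ε (n := 0)).continuous

/-- The bracket `(1 + 2εs)P₃(s) − P₃′(s) ≥ 1/2` for `ε, s ≥ 0` (`P₃ − P₃′ = 1/2 + 3s/8 + s²/32 + s³/96`).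
[folklore] -/
private theorem bracket3_pos {ε s : ℝ} (hε : 0 ≤ ε) (hs : 0 ≤ s) :
    1 / 2 ≤ (1 + 2 * ε * s) * P3 s - P3' s := by
  have hP : 0 ≤ P3 s := (P3_pos hs).le
  have h1 : 0 ≤ 2 * ε * s * P3 s := by positivity
  have h2 : P3 s - P3' s = 1 / 2 + 3 * s / 8 + s ^ 2 / 32 + s ^ 3 / 96 := by rw [P3, P3']; ring
  have h3 : 0 ≤ 3 * s / 8 + s ^ 2 / 32 + s ^ 3 / 96 := by positivity
  nlinarith

/-- `K₃,ε′(t) < 0` for `t > 0`, `ε ≥ 0` ((iv)). [cite: DimitrovLucas2011, Definition 1 (iv)] -/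
theorem deriv_K3_neg {ε : ℝ} (hε : 0 ≤ ε) {t : ℝ} (ht : 0 < t) : deriv (K3 ε) t < 0 := by
  rw [deriv_K3, dK3, neg_lt_zero]
  have hb := bracket3_pos hε (sq_nonneg t)
  have : 0 < (1 + 2 * ε * t ^ 2) * P3 (t ^ 2) - P3' (t ^ 2) := by linarith
  positivity

/-- For `t > 0`: `−K₃,ε′(t)/(tK₃,ε(t)) = 2(1 + 2εt²) − 2P₃′(t²)/P₃(t²)`. [folklore] -/
private theorem neg_deriv_K3_div (ε : ℝ) {t : ℝ} (ht : 0 < t) :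
    -deriv (K3 ε) t / (t * K3 ε t) = 2 * (1 + 2 * ε * t ^ 2) - 2 * P3' (t ^ 2) / P3 (t ^ 2) := by
  rw [deriv_K3, dK3, K3]
  have hP := (P3_pos (sq_nonneg t)).ne'
  have hE := (Real.exp_pos (-t ^ 2 - ε * t ^ 4)).ne'
  have ht' := ht.ne'
  field_simp

/-- `s ↦ P₃′(s)/P₃(s)` is strictly decreasing on `[0,∞)` (its derivative is `−(P₃′² − P₃P₃″)/P₃² < 0`).
[folklore] -/
private theorem P3'_div_P3_strictAntiOn : StrictAntiOn (fun s : ℝ => P3' s / P3 s) (Ici 0) := by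
  refine strictAntiOn_of_deriv_neg (convex_Ici 0) ?_ fun s hs => ?_
  · have : ∀ s ∈ Ici (0 : ℝ), P3 s ≠ 0 := fun s hs => (P3_pos hs).ne'
    unfold P3' P3 at this ⊢
    exact ContinuousOn.div (by fun_prop) (by fun_prop) this
  · rw [interior_Ici] at hs
    have hs' : 0 ≤ s := le_of_lt hs
    have hP := P3_pos hs'
    rw [((hasDerivAt_P3' s).fun_div (hasDerivAt_P3 s) hP.ne').deriv]
    have hnum : P3'' s * P3 s - P3' s * P3' s < 0 := by
      have := laguerre_P3_pos hs'; nlinarith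
    exact div_neg_of_neg_of_pos hnum (by positivity)

/-- **Log-concavity of `K₃,ε(√t)`, tree shape**: `t ↦ −K₃,ε′(t)/(tK₃,ε(t))` is strictly increasing on
`(0,∞)` (`ε ≥ 0`). [cite: DimitrovLucas2011, (8) and the remark after Theorem B] -/
theorem strictMonoOn_neg_deriv_K3_div {ε : ℝ} (hε : 0 ≤ ε) :
    StrictMonoOn (fun t : ℝ => -deriv (K3 ε) t / (t * K3 ε t)) (Ioi 0) := by
  intro a ha b hb hab
  have ha' : 0 < a := ha
  have hb' : 0 < b := hb
  show -deriv (K3 ε) a / (a * K3 ε a) < -deriv (K3 ε) b / (b * K3 ε b)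
  rw [neg_deriv_K3_div ε ha', neg_deriv_K3_div ε hb']
  have hab2 : a ^ 2 < b ^ 2 := by nlinarith
  have h1 : P3' (b ^ 2) / P3 (b ^ 2) < P3' (a ^ 2) / P3 (a ^ 2) :=
    P3'_div_P3_strictAntiOn (sq_nonneg a) (sq_nonneg b) hab2
  have h1' : 2 * P3' (b ^ 2) / P3 (b ^ 2) < 2 * P3' (a ^ 2) / P3 (a ^ 2) := by
    rw [mul_div_assoc, mul_div_assoc]; linarith
  have h2 : ε * a ^ 2 ≤ ε * b ^ 2 := mul_le_mul_of_nonneg_left hab2.le hε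
  linarith

/-- `log K₃,ε(√s) = −s − εs² + log P₃(s)` for `s ≥ 0`. [cite: DimitrovLucas2011, (8)] -/
theorem log_K3_sqrt {ε s : ℝ} (hs : 0 ≤ s) :
    Real.log (K3 ε (Real.sqrt s)) = -s - ε * s ^ 2 + Real.log (P3 s) := by
  have h4 : Real.sqrt s ^ 4 = s ^ 2 := by
    rw [show (4 : ℕ) = 2 * 2 from rfl, pow_mul, Real.sq_sqrt hs]
  rw [K3, Real.log_mul (Real.exp_pos _).ne' (P3_pos (by rw [Real.sq_sqrt hs]; exact hs)).ne',
    Real.log_exp, Real.sq_sqrt hs, h4]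

/-- First derivative of the smooth model `−s − εs² + log P₃(s)` (for `s ≥ 0`). [folklore] -/
private theorem hasDerivAt_logModel3 (ε : ℝ) {s : ℝ} (hs : 0 ≤ s) :
    HasDerivAt (fun s : ℝ => -s - ε * s ^ 2 + Real.log (P3 s)) (-1 - ε * (2 * s) + P3' s / P3 s) s := by
  have h1 : HasDerivAt (fun s : ℝ => -s - ε * s ^ 2) (-1 - ε * (2 * s)) s := by
    have h := ((hasDerivAt_id' s).fun_neg).fun_sub ((hasDerivAt_pow 2 s).const_mul ε)
    refine h.congr_deriv ?_
    simp
  exact h1.fun_add ((hasDerivAt_P3 s).log (P3_pos hs).ne')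

/-- Second derivative of the model: `−2ε + (P₃″P₃ − P₃′²)/P₃²` (for `s ≥ 0`). [folklore] -/
private theorem hasDerivAt_logModel3_deriv (ε : ℝ) {s : ℝ} (hs : 0 ≤ s) :
    HasDerivAt (fun s : ℝ => -1 - ε * (2 * s) + P3' s / P3 s)
      (-(ε * 2) + (P3'' s * P3 s - P3' s * P3' s) / P3 s ^ 2) s := by
  have h1 : HasDerivAt (fun s : ℝ => -1 - ε * (2 * s)) (-(ε * 2)) s := by
    have h := (((hasDerivAt_id' s).const_mul (2 : ℝ)).const_mul ε).const_sub (-1 : ℝ)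
    refine h.congr_deriv ?_
    simp
  exact h1.fun_add ((hasDerivAt_P3' s).fun_div (hasDerivAt_P3 s) (P3_pos hs).ne')

/-- **(8) literally for `K₃,ε`**: `(d²/ds²) log K₃,ε(√s) < 0` for every `s > 0` and `ε ≥ 0`; indeed
`= −2ε − (1/8 + s²/128 + s³/384 + s⁴/3072)/P₃(s)²`. [cite: DimitrovLucas2011, (8)] -/
theorem deriv2_log_K3_sqrt_neg {ε : ℝ} (hε : 0 ≤ ε) {s : ℝ} (hs : 0 < s) :
    deriv^[2] (fun s : ℝ => Real.log (K3 ε (Real.sqrt s))) s < 0 := by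
  have hloc : (fun s : ℝ => Real.log (K3 ε (Real.sqrt s))) =ᶠ[𝓝 s]
      fun s : ℝ => -s - ε * s ^ 2 + Real.log (P3 s) := by
    filter_upwards [Ioi_mem_nhds hs] with x hx using log_K3_sqrt hx.le
  have hd1 : deriv (fun s : ℝ => Real.log (K3 ε (Real.sqrt s))) =ᶠ[𝓝 s]
      fun s : ℝ => -1 - ε * (2 * s) + P3' s / P3 s := by
    have hev : ∀ᶠ x in 𝓝 s, 0 < x := Ioi_mem_nhds hs
    refine (hloc.eventually_nhds.and hev).mono fun x hx => ?_
    have hx' : (fun s : ℝ => Real.log (K3 ε (Real.sqrt s))) =ᶠ[𝓝 x]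
        fun s : ℝ => -s - ε * s ^ 2 + Real.log (P3 s) := hx.1
    rw [hx'.deriv_eq]
    exact (hasDerivAt_logModel3 ε hx.2.le).deriv
  show deriv (deriv fun s : ℝ => Real.log (K3 ε (Real.sqrt s))) s < 0
  rw [hd1.deriv_eq, (hasDerivAt_logModel3_deriv ε hs.le).deriv]
  have hP := P3_pos hs.le
  have hnum : P3'' s * P3 s - P3' s * P3' s < 0 := by
    have := laguerre_P3_pos hs.le; nlinarith
  have : (P3'' s * P3 s - P3' s * P3' s) / P3 s ^ 2 < 0 := div_neg_of_neg_of_pos hnum (by positivity)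
  nlinarith

/-- Gaussian domination: `K₃,ε(t) ≤ e^{−t²/2}` (`ε ≥ 0`), since
`P₃(s) ≤ (1 + s/4 + s²/32)² ≤ (e^{s/4})² = e^{s/2}`. [cite: DimitrovLucas2011, Definition 1 (v)] -/
theorem K3_le_gaussian {ε : ℝ} (hε : 0 ≤ ε) (t : ℝ) : K3 ε t ≤ Real.exp (-t ^ 2 / 2) := by
  rw [K3]
  have ht2 : 0 ≤ t ^ 2 := sq_nonneg t
  have hq : 1 + t ^ 2 / 4 + (t ^ 2 / 4) ^ 2 / 2 ≤ Real.exp (t ^ 2 / 4) :=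
    Real.quadratic_le_exp_of_nonneg (by positivity)
  have hq0 : 0 ≤ 1 + t ^ 2 / 4 + (t ^ 2 / 4) ^ 2 / 2 := by positivity
  have hP : P3 (t ^ 2) ≤ Real.exp (t ^ 2 / 2) := by
    have h1 : P3 (t ^ 2) ≤ (1 + t ^ 2 / 4 + (t ^ 2 / 4) ^ 2 / 2) ^ 2 := by
      rw [P3]; nlinarith [sq_nonneg t, pow_nonneg ht2 3, pow_nonneg ht2 4]
    have h2 : (1 + t ^ 2 / 4 + (t ^ 2 / 4) ^ 2 / 2) ^ 2 ≤ Real.exp (t ^ 2 / 4) ^ 2 :=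
      pow_le_pow_left₀ hq0 hq 2
    have h3 : Real.exp (t ^ 2 / 4) ^ 2 = Real.exp (t ^ 2 / 2) := by
      rw [← Real.exp_nat_mul]; ring_nf
    linarith [h3 ▸ h2]
  have hE : Real.exp (-t ^ 2 - ε * t ^ 4) ≤ Real.exp (-t ^ 2) :=
    Real.exp_le_exp.2 (by nlinarith [mul_nonneg hε (show (0:ℝ) ≤ t ^ 4 by positivity)])
  calc Real.exp (-t ^ 2 - ε * t ^ 4) * P3 (t ^ 2)
      ≤ Real.exp (-t ^ 2) * Real.exp (t ^ 2 / 2) :=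
        mul_le_mul hE hP (P3_pos ht2).le (Real.exp_pos _).le
    _ = Real.exp (-t ^ 2 / 2) := by
        rw [← Real.exp_add]; ring_nf

/-- `K₃,ε` (`ε ≥ 0`) is integrable over `ℝ`. [folklore] -/
private theorem integrable_K3 {ε : ℝ} (hε : 0 ≤ ε) : Integrable (K3 ε) := by
  have hg : Integrable fun t : ℝ => Real.exp (-(1 / 2) * t ^ 2) :=
    integrable_exp_neg_mul_sq (by norm_num : (0 : ℝ) < 1 / 2)
  refine hg.mono' (continuous_K3 ε).aestronglyMeasurable (Eventually.of_forall fun t => ?_)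
  rw [Real.norm_eq_abs, abs_of_pos (K3_pos ε t)]
  have h := K3_le_gaussian hε t
  convert h using 2
  ring

/-! ### Exact moments of `K₃,₀ = e^{−t²}P₃(t²)` -/

/-- `K₃,₀(t)t^{2m} = e^{−t²}t^{2m} + e^{−t²}t^{2m+2}/2 + e^{−t²}t^{2m+4}/16 + e^{−t²}t^{2m+6}/96`. [folklore] -/
private theorem K3_zero_mul_pow (m : ℕ) (t : ℝ) :
    K3 0 t * t ^ (2 * m) = Real.exp (-t ^ 2) * t ^ (2 * m) +
      (1 / 2 * (Real.exp (-t ^ 2) * t ^ (2 * (m + 1))) +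
        (1 / 16 * (Real.exp (-t ^ 2) * t ^ (2 * (m + 2))) +
          1 / 96 * (Real.exp (-t ^ 2) * t ^ (2 * (m + 3))))) := by
  simp only [K3, P3, zero_mul, sub_zero]
  ring

/-- The integrand `K₃,ε(t)t^{2m}` is dominated by `K₃,₀(t)t^{2m}` on `(0,∞)` for `ε ≥ 0`. [folklore] -/
private theorem K3_mul_pow_le {ε : ℝ} (hε : 0 ≤ ε) {t : ℝ} (ht : 0 ≤ t) (m : ℕ) :
    K3 ε t * t ^ (2 * m) ≤ K3 0 t * t ^ (2 * m) := by
  refine mul_le_mul_of_nonneg_right ?_ (by positivity)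
  simp only [K3, zero_mul, sub_zero]
  refine mul_le_mul_of_nonneg_right (Real.exp_le_exp.2 ?_) (P3_pos (sq_nonneg t)).le
  nlinarith [mul_nonneg hε (show (0 : ℝ) ≤ t ^ 4 by positivity)]

/-- `K₃,₀(t)t^{2m}` is integrable on `(0,∞)`. [folklore] -/
private theorem integrableOn_K3_zero_mul_pow (m : ℕ) :
    IntegrableOn (fun t : ℝ => K3 0 t * t ^ (2 * m)) (Ioi 0) := by
  have e : (fun t : ℝ => K3 0 t * t ^ (2 * m)) = fun t : ℝ => Real.exp (-t ^ 2) * t ^ (2 * m) +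
      (1 / 2 * (Real.exp (-t ^ 2) * t ^ (2 * (m + 1))) +
        (1 / 16 * (Real.exp (-t ^ 2) * t ^ (2 * (m + 2))) +
          1 / 96 * (Real.exp (-t ^ 2) * t ^ (2 * (m + 3))))) := funext (K3_zero_mul_pow m)
  rw [e]
  exact (integrableOn_exp_neg_sq_mul_pow m).add
    (((integrableOn_exp_neg_sq_mul_pow (m + 1)).const_mul _).add
      (((integrableOn_exp_neg_sq_mul_pow (m + 2)).const_mul _).add
        ((integrableOn_exp_neg_sq_mul_pow (m + 3)).const_mul _)))

/-- The moments `b_m(K₃,ε)` exist for every `ε ≥ 0`. [cite: DimitrovLucas2011, p. 1015] -/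
theorem integrableOn_K3_mul_pow {ε : ℝ} (hε : 0 ≤ ε) (m : ℕ) :
    IntegrableOn (fun t : ℝ => K3 ε t * t ^ (2 * m)) (Ioi 0) := by
  refine Integrable.mono' (integrableOn_K3_zero_mul_pow m)
    (((continuous_K3 ε).mul (continuous_pow _)).aestronglyMeasurable) ?_
  filter_upwards [ae_restrict_mem measurableSet_Ioi] with t ht
  rw [Real.norm_eq_abs, abs_of_nonneg (mul_nonneg (K3_pos ε t).le (pow_nonneg (le_of_lt ht) _))]
  exact K3_mul_pow_le hε (le_of_lt ht) m

/-- The CUBIC `μ(m) = 1 + (m+½)/2 + (m+½)(m+3/2)/16 + (m+½)(m+3/2)(m+5/2)/96`: the Taylor sequence of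
`K₃,₀` with the factor `(√π/2)4^{−m}` removed. [folklore] -/
def mu3 (m : ℕ) : ℝ :=
  1 + 1 / 2 * ((m : ℝ) + 1 / 2) + 1 / 16 * (((m : ℝ) + 1 / 2) * ((m : ℝ) + 3 / 2)) +
    1 / 96 * (((m : ℝ) + 1 / 2) * ((m : ℝ) + 3 / 2) * ((m : ℝ) + 5 / 2))

/-- `μ(m) > 0`. [folklore] -/
private theorem mu3_pos (m : ℕ) : 0 < mu3 m := by
  have hm : (0 : ℝ) ≤ m := Nat.cast_nonneg m
  unfold mu3
  positivity

/-- **Exact moments of `K₃,₀`**: `b_m(K₃,₀) = Γ(m + ½)/2 · μ(m)`. [cite: DimitrovLucas2011, p. 1015] -/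
theorem kernelMoment_K3_zero (m : ℕ) : kernelMoment (K3 0) m = Real.Gamma (m + 1 / 2) / 2 * mu3 m := by
  rw [kernelMoment]
  have e : (fun t : ℝ => K3 0 t * t ^ (2 * m)) = fun t : ℝ => Real.exp (-t ^ 2) * t ^ (2 * m) +
      (1 / 2 * (Real.exp (-t ^ 2) * t ^ (2 * (m + 1))) +
        (1 / 16 * (Real.exp (-t ^ 2) * t ^ (2 * (m + 2))) +
          1 / 96 * (Real.exp (-t ^ 2) * t ^ (2 * (m + 3))))) := funext (K3_zero_mul_pow m)
  have hA : IntegrableOn (fun t : ℝ => 1 / 2 * (Real.exp (-t ^ 2) * t ^ (2 * (m + 1)))) (Ioi 0) :=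
    (integrableOn_exp_neg_sq_mul_pow (m + 1)).const_mul _
  have hB : IntegrableOn (fun t : ℝ => 1 / 16 * (Real.exp (-t ^ 2) * t ^ (2 * (m + 2)))) (Ioi 0) :=
    (integrableOn_exp_neg_sq_mul_pow (m + 2)).const_mul _
  have hC : IntegrableOn (fun t : ℝ => 1 / 96 * (Real.exp (-t ^ 2) * t ^ (2 * (m + 3)))) (Ioi 0) :=
    (integrableOn_exp_neg_sq_mul_pow (m + 3)).const_mul _
  have hBC : IntegrableOn (fun t : ℝ => 1 / 16 * (Real.exp (-t ^ 2) * t ^ (2 * (m + 2))) +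
      1 / 96 * (Real.exp (-t ^ 2) * t ^ (2 * (m + 3)))) (Ioi 0) := hB.add hC
  have hABC : IntegrableOn (fun t : ℝ => 1 / 2 * (Real.exp (-t ^ 2) * t ^ (2 * (m + 1))) +
      (1 / 16 * (Real.exp (-t ^ 2) * t ^ (2 * (m + 2))) +
        1 / 96 * (Real.exp (-t ^ 2) * t ^ (2 * (m + 3))))) (Ioi 0) := hA.add hBC
  rw [e, integral_add (integrableOn_exp_neg_sq_mul_pow m) hABC, integral_add hA hBC, integral_add hB hC,
    integral_const_mul, integral_const_mul, integral_const_mul, integral_exp_neg_sq_mul_pow,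
    integral_exp_neg_sq_mul_pow, integral_exp_neg_sq_mul_pow, integral_exp_neg_sq_mul_pow]
  have hpos : (0 : ℝ) < m + 1 / 2 := by positivity
  have h1 : Real.Gamma (((m + 1 : ℕ) : ℝ) + 1 / 2) = ((m : ℝ) + 1 / 2) * Real.Gamma (m + 1 / 2) := by
    rw [Nat.cast_succ, show (m : ℝ) + 1 + 1 / 2 = ((m : ℝ) + 1 / 2) + 1 by ring,
      Real.Gamma_add_one hpos.ne']
  have h2 : Real.Gamma (((m + 2 : ℕ) : ℝ) + 1 / 2) =
      ((m : ℝ) + 3 / 2) * (((m : ℝ) + 1 / 2) * Real.Gamma (m + 1 / 2)) := by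
    rw [Nat.cast_add, Nat.cast_two, show (m : ℝ) + 2 + 1 / 2 = ((m : ℝ) + 1 / 2 + 1) + 1 by ring,
      Real.Gamma_add_one (by positivity), Real.Gamma_add_one hpos.ne']
    ring
  have h3 : Real.Gamma (((m + 3 : ℕ) : ℝ) + 1 / 2) =
      ((m : ℝ) + 5 / 2) * (((m : ℝ) + 3 / 2) * (((m : ℝ) + 1 / 2) * Real.Gamma (m + 1 / 2))) := by
    rw [Nat.cast_add, show ((3 : ℕ) : ℝ) = 3 by norm_num,
      show (m : ℝ) + 3 + 1 / 2 = (((m : ℝ) + 1 / 2 + 1) + 1) + 1 by ring,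
      Real.Gamma_add_one (by positivity), Real.Gamma_add_one (by positivity), Real.Gamma_add_one hpos.ne']
    ring
  rw [h1, h2, h3, mu3]
  ring

/-- **Closed form of the Taylor sequence of `K₃,₀`**: `γ_m(K₃,₀) = (√π/2)·4^{−m}·μ(m)` with `μ` CUBIC in
`m`. [cite: DimitrovLucas2011, p. 1015] -/
theorem kernelTaylorSeq_K3_zero (m : ℕ) :
    kernelTaylorSeq (K3 0) m = Real.sqrt π / 2 * (1 / 4) ^ m * mu3 m := by
  rw [kernelTaylorSeq, kernelMoment_K3_zero, ← mul_assoc, factorial_div_mul_Gamma_half]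

/-- The same, as an identity of sequences. [folklore] -/
private theorem kernelTaylorSeq_K3_zero_eq :
    kernelTaylorSeq (K3 0) = fun m => Real.sqrt π / 2 * (1 / 4) ^ m * mu3 m :=
  funext kernelTaylorSeq_K3_zero

/-- The exact values behind the sign: `μ(0..4) = 337/256, 543/256, 821/256, 1187/256, 1657/256`,
`T_1(μ), T_2(μ), T_3(μ) = 4543/2¹⁴, 7375/2¹⁴, 12143/2¹⁴` (all positive — row 2) and
`E_2(μ) = T_2² − T_1T_3 = −48439/2²⁴`. [cite: Csordas2015, §4 (4.5) and before Open Problem 4.14] -/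
theorem doubleTuran_mu3_two :
    turanDiff mu3 1 = 4543 / 16384 ∧ turanDiff mu3 2 = 7375 / 16384 ∧ turanDiff mu3 3 = 12143 / 16384 ∧
      doubleTuran mu3 2 = -48439 / 16777216 := by
  refine ⟨?_, ?_, ?_, ?_⟩ <;> norm_num [doubleTuran, turanDiff, mu3]

/-- **`E_2(γ(K₃,₀)) < 0`**: the first double Turán inequality FAILS for the Taylor sequence
`γ_m = m! b_m/(2m)!` of `K₃,₀ = e^{−t²}(1 + t²/2 + t⁴/16 + t⁶/96)`; exactly,
`E_2 = (√π/2)⁴·4^{−8}·(−48439/2²⁴) = −48439·π²/2⁴⁴`. [cite: Csordas2015, §4, before Open Problem 4.14] -/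
theorem doubleTuran_K3_zero_two : doubleTuran (kernelTaylorSeq (K3 0)) 2 = -(48439 / 2 ^ 44) * π ^ 2 := by
  rw [kernelTaylorSeq_K3_zero_eq, doubleTuran_two_const_mul_pow_mul, doubleTuran_mu3_two.2.2.2]
  have h4 : (Real.sqrt π / 2) ^ 4 = π ^ 2 / 16 := by
    rw [div_pow, show (4 : ℕ) = 2 * 2 from rfl, pow_mul, Real.sq_sqrt Real.pi_pos.le]; norm_num
  rw [h4]
  ring

/-- `E_2(γ(K₃,₀)) < 0`. [cite: Csordas2015, §4, before Open Problem 4.14] -/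
theorem doubleTuran_K3_zero_two_neg : doubleTuran (kernelTaylorSeq (K3 0)) 2 < 0 := by
  rw [doubleTuran_K3_zero_two]
  have : 0 < π ^ 2 := by positivity
  nlinarith

/-! ### `K₃,ε` is admissible for `ε > 0`: (ii) entire, (v) super-Gaussian decay of all derivatives -/

/-- The entire function `exp(−z² − εz⁴)(1 + z²/2 + z⁴/16 + z⁶/96)` extending `K₃,ε`.
[cite: DimitrovLucas2011, Definition 1 (ii)] -/
def K3C (ε : ℝ) (z : ℂ) : ℂ :=
  Complex.exp (-z ^ 2 - (ε : ℂ) * z ^ 4) * (1 + z ^ 2 / 2 + (z ^ 2) ^ 2 / 16 + (z ^ 2) ^ 3 / 96)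

/-- (ii) `K3C ε` is entire. [cite: DimitrovLucas2011, Definition 1 (ii)] -/
theorem differentiable_K3C (ε : ℝ) : Differentiable ℂ (K3C ε) := by
  unfold K3C
  fun_prop

/-- (ii) `K3C ε` restricts to `K₃,ε` on `ℝ`. [cite: DimitrovLucas2011, Definition 1 (ii)] -/
theorem K3C_ofReal (ε t : ℝ) : K3C ε (t : ℂ) = ((K3 ε t : ℝ) : ℂ) := by
  simp only [K3C, K3, P3]
  push_cast
  ring

/-- The sextic `P₃(X²) = 1 + X²/2 + X⁴/16 + X⁶/96` as a polynomial. [folklore] -/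
def p3Poly : ℝ[X] := 1 + C (1 / 2) * X ^ 2 + C (1 / 16) * X ^ 4 + C (1 / 96) * X ^ 6

/-- `K₃,ε(t) = P₃(t²)·exp(g_ε(t))` with the exponent polynomial `gPoly ε = −X² − εX⁴` of the first
witness family. [folklore] -/
private theorem K3_eq_eval (ε t : ℝ) : K3 ε t = p3Poly.eval t * Real.exp ((gPoly ε).eval t) := by
  simp only [K3, P3, gPoly, p3Poly, eval_add, eval_sub, eval_neg, eval_mul, eval_pow, eval_C, eval_X,
    eval_one]
  ring_nf

/-- Every derivative of `K₃,ε` is `Q_n(t)·e^{−t²−εt⁴}` with `Q_n` a real polynomial.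
[cite: DimitrovLucas2011, Definition 1 (v)] -/
theorem exists_iteratedDeriv_K3_eq (ε : ℝ) (n : ℕ) :
    ∃ Q : ℝ[X], iteratedDeriv n (K3 ε) = fun t => Q.eval t * Real.exp ((gPoly ε).eval t) := by
  induction n with
  | zero => exact ⟨p3Poly, by rw [iteratedDeriv_zero]; funext t; exact K3_eq_eval ε t⟩
  | succ n ih =>
    obtain ⟨Q, hQ⟩ := ih
    refine ⟨derivative Q + Q * derivative (gPoly ε), ?_⟩
    rw [iteratedDeriv_succ, hQ]
    funext t
    exact (hasDerivAt_eval_mul_exp Q (gPoly ε) t).deriv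

/-- **(v) for `K₃,ε`, `ε > 0`**: every derivative is `O(e^{−t³})` at `+∞`. [cite: DimitrovLucas2011, Definition 1 (v)] -/
theorem iteratedDeriv_K3_isBigO {ε : ℝ} (hε : 0 < ε) (n : ℕ) :
    iteratedDeriv n (K3 ε) =O[atTop] fun t : ℝ => Real.exp (-t ^ 3) := by
  obtain ⟨Q, hQ⟩ := exists_iteratedDeriv_K3_eq ε n
  rw [hQ]
  exact eval_mul_exp_isBigO hε Q

/-- (v) in the printed shape `K₃,ε^{(n)}(t) = O(exp(−|t|^{2+δ}))`, `δ = 1`. [cite: DimitrovLucas2011, Definition 1 (v)] -/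
theorem iteratedDeriv_K3_isBigO_rpow {ε : ℝ} (hε : 0 < ε) (n : ℕ) :
    iteratedDeriv n (K3 ε) =O[atTop] fun t : ℝ => Real.exp (-|t| ^ ((2 : ℝ) + 1)) := by
  refine (iteratedDeriv_K3_isBigO hε n).congr' Filter.EventuallyEq.rfl ?_
  filter_upwards [eventually_ge_atTop (0 : ℝ)] with t ht
  rw [abs_of_nonneg ht, show (2 : ℝ) + 1 = ((3 : ℕ) : ℝ) by norm_num, Real.rpow_natCast]

/-- (v) at `n = 0`: `K₃,ε = O(exp(−|t|³))` for `ε > 0`. [cite: DimitrovLucas2011, Definition 1 (v)] -/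
theorem K3_isBigO_rpow {ε : ℝ} (hε : 0 < ε) :
    K3 ε =O[atTop] fun t : ℝ => Real.exp (-|t| ^ ((2 : ℝ) + 1)) := by
  simpa only [iteratedDeriv_zero] using iteratedDeriv_K3_isBigO_rpow hε 0

/-- **`K₃,ε` (`ε > 0`) is admissible with (8)** — every hypothesis of Dimitrov–Lucas' Theorem 1 as typed
in `not_dimitrovLucas2011_theorem1` ((i) positive; (ii) an entire extension; (iii) even; (iv) `K′ < 0`
on `(0,∞)`; (v) all derivatives `O(exp(−|t|³))`; (8) `(log K(√s))″ < 0`), plus the tree's monotone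
shape of (8). [cite: DimitrovLucas2011, Definition 1 and (8)] -/
theorem K3_admissible {ε : ℝ} (hε : 0 < ε) :
    (∀ t, 0 < K3 ε t) ∧ (∃ F : ℂ → ℂ, Differentiable ℂ F ∧ ∀ t : ℝ, F t = K3 ε t) ∧
      (∀ t, K3 ε (-t) = K3 ε t) ∧ (∀ t, 0 < t → deriv (K3 ε) t < 0) ∧
      (∃ δ : ℝ, 0 < δ ∧ ∀ n : ℕ, iteratedDeriv n (K3 ε) =O[atTop] fun t => Real.exp (-|t| ^ (2 + δ))) ∧
      (∀ s, 0 < s → deriv^[2] (fun s => Real.log (K3 ε (Real.sqrt s))) s < 0) ∧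
      StrictMonoOn (fun t => -deriv (K3 ε) t / (t * K3 ε t)) (Ioi 0) :=
  ⟨K3_pos ε, ⟨K3C ε, differentiable_K3C ε, K3C_ofReal ε⟩, K3_even ε, fun _ ht => deriv_K3_neg hε.le ht,
    ⟨1, one_pos, iteratedDeriv_K3_isBigO_rpow hε⟩, fun _ hs => deriv2_log_K3_sqrt_neg hε.le hs,
    strictMonoOn_neg_deriv_K3_div hε.le⟩

/-- **Row 2 for `K₃,ε`, `ε > 0`**: `T_k(γ(K₃,ε)) > 0` for all `k ≥ 1` (the positive side).
[cite: Csordas2015, §4 (4.5)] -/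
theorem turanDiff_K3_pos {ε : ℝ} (hε : 0 < ε) {k : ℕ} (hk : 1 ≤ k) :
    0 < turanDiff (kernelTaylorSeq (K3 ε)) k :=
  turanDiff_pos_of_logConcaveSqrt (contDiff_K3 ε) (integrable_K3 hε.le) (K3_pos ε) ⟨1, one_pos, K3_isBigO_rpow hε⟩
    (fun _ hs => deriv2_log_K3_sqrt_neg hε.le hs) hk

/-! ### Continuity of the moments at `ε = 0⁺` and the sign of `E_2(K₃,ε)` for small `ε > 0` -/

/-- `ε ↦ K₃,ε(t)` is continuous. [folklore] -/
private theorem continuous_K3_param (t : ℝ) : Continuous fun ε : ℝ => K3 ε t := by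
  unfold K3
  fun_prop

/-- The moments `b_m(K₃,ε)` are continuous in `ε` at `0` from the right (dominated convergence with
dominating function `K₃,₀(t)t^{2m}`). [folklore] -/
private theorem continuousWithinAt_kernelMoment_K3 (m : ℕ) :
    ContinuousWithinAt (fun ε : ℝ => kernelMoment (K3 ε) m) (Ici 0) 0 := by
  unfold kernelMoment
  refine continuousWithinAt_of_dominated (bound := fun t => K3 0 t * t ^ (2 * m)) ?_ ?_ ?_ ?_
  · exact Eventually.of_forall fun ε => ((continuous_K3 ε).mul (continuous_pow _)).aestronglyMeasurable
  · filter_upwards [self_mem_nhdsWithin] with ε hε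
    filter_upwards [ae_restrict_mem measurableSet_Ioi] with t ht
    rw [Real.norm_eq_abs, abs_of_nonneg (mul_nonneg (K3_pos ε t).le (pow_nonneg (le_of_lt ht) _))]
    exact K3_mul_pow_le hε (le_of_lt ht) m
  · exact integrableOn_K3_zero_mul_pow m
  · exact Eventually.of_forall fun t => ((continuous_K3_param t).mul continuous_const).continuousWithinAt

/-- The Taylor sequence `γ(K₃,ε) → γ(K₃,₀)` as `ε → 0⁺` (product topology). [folklore] -/
private theorem tendsto_kernelTaylorSeq_K3 :
    Tendsto (fun ε : ℝ => kernelTaylorSeq (K3 ε)) (𝓝[Ici 0] 0) (𝓝 (kernelTaylorSeq (K3 0))) := by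
  refine tendsto_pi_nhds.2 fun m => ?_
  have h := (continuousWithinAt_kernelMoment_K3 m).tendsto
  simp only [kernelTaylorSeq]
  exact h.const_mul _

/-- For all sufficiently small `ε ≥ 0`: `E_2(γ(K₃,ε)) < 0`. [cite: Csordas2015, §4, before Open Problem 4.14] -/
theorem eventually_doubleTuran_K3_two_neg :
    ∀ᶠ ε in 𝓝[Ici 0] (0 : ℝ), doubleTuran (kernelTaylorSeq (K3 ε)) 2 < 0 := by
  have h1 : Tendsto (fun ε : ℝ => doubleTuran (kernelTaylorSeq (K3 ε)) 2) (𝓝[Ici 0] 0)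
      (𝓝 (doubleTuran (kernelTaylorSeq (K3 0)) 2)) :=
    (continuous_doubleTuran_two.tendsto _).comp tendsto_kernelTaylorSeq_K3
  exact h1.eventually (gt_mem_nhds doubleTuran_K3_zero_two_neg)

/-- **There is `ε > 0` with `E_2(γ(K₃,ε)) < 0`** (an admissible member of the family).
[cite: Csordas2015, §4, before Open Problem 4.14] -/
theorem exists_pos_doubleTuran_K3_two_neg :
    ∃ ε : ℝ, 0 < ε ∧ doubleTuran (kernelTaylorSeq (K3 ε)) 2 < 0 := by
  have h : ∀ᶠ ε in 𝓝[>] (0 : ℝ), doubleTuran (kernelTaylorSeq (K3 ε)) 2 < 0 :=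
    eventually_doubleTuran_K3_two_neg.filter_mono (nhdsWithin_mono _ Ioi_subset_Ici_self)
  obtain ⟨ε, hε, h0⟩ := (h.and self_mem_nhdsWithin).exists
  exact ⟨ε, h0, hε⟩

end DoubleTuranWitness

open DoubleTuranWitness in
/-- **First-level log-concavity does not give the double Turán inequalities.** There is a kernel `K`,
ADMISSIBLE in the sense of Dimitrov–Lucas, Definition 1 ((i) `K > 0`; (ii) an entire extension;
(iii) even; (iv) `K′ < 0` on `(0,∞)`; (v) every derivative `O(exp(−|t|³))`), with (8) in both shapes
(`(d²/ds²) log K(√s) < 0` on `(0,∞)`; `t ↦ −K′(t)/(tK(t))` strictly increasing), whose Taylor sequence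
`γ_k = k! b_k/(2k)!` (`b_k = ∫₀^∞ t^{2k}K`) satisfies ALL the Turán inequalities `T_k > 0` (`k ≥ 1`, the
positive side) and yet VIOLATES the first double Turán inequality: `E_2 = T_2² − T_1T_3 < 0`. Witness:
`K₃,ε = e^{−t²−εt⁴}(1 + t²/2 + t⁴/16 + t⁶/96)` for a suitable `ε > 0` (`E_2(γ(K₃,₀)) = −48439·π²/2⁴⁴`
exactly, `doubleTuran_K3_zero_two`; `ε > 0` by dominated convergence). So, within the technique class of
`JensenPolynomialsLogConcaveKernel`, the SECOND-level concavity input of Csordas–Dimitrov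
(`(log (s′² − ss″))″ < 0`, `s = K(√t)`; proved for `Φ` by Planat–Solé 2026) is not redundant for the
double Turán inequalities. [cite: Csordas2015, §4, (4.5) and the paragraph before Open Problem 4.14]
[cite: PlanatSole2026, Theorem 1.1 and §7] [cite: DimitrovLucas2011, Definition 1 and (8)] -/
theorem exists_admissible_doubleTuran_neg :
    ∃ K : ℝ → ℝ, (∀ t, 0 < K t) ∧ (∃ F : ℂ → ℂ, Differentiable ℂ F ∧ ∀ t : ℝ, F t = K t) ∧
      (∀ t, K (-t) = K t) ∧ (∀ t, 0 < t → deriv K t < 0) ∧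
      (∃ δ : ℝ, 0 < δ ∧ ∀ n : ℕ, iteratedDeriv n K =O[atTop] fun t => Real.exp (-|t| ^ (2 + δ))) ∧
      (∀ s, 0 < s → deriv^[2] (fun s => Real.log (K (Real.sqrt s))) s < 0) ∧
      StrictMonoOn (fun t => -deriv K t / (t * K t)) (Ioi 0) ∧
      (∀ k, 1 ≤ k → 0 < turanDiff (kernelTaylorSeq K) k) ∧
      doubleTuran (kernelTaylorSeq K) 2 < 0 := by
  obtain ⟨ε, hε, hE⟩ := exists_pos_doubleTuran_K3_two_neg
  obtain ⟨h1, h2, h3, h4, h5, h6, h7⟩ := K3_admissible hε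
  exact ⟨K3 ε, h1, h2, h3, h4, h5, h6, h7, fun _ hk => turanDiff_K3_pos hε hk, hE⟩

/-- **The double Turán inequalities are not a consequence of the log-concavity class.** It is NOT the case
that for every admissible kernel `K` (Definition 1, here even with an entire extension) with
`(log K(√t))″ < 0` for `t > 0` the sequence `γ_k = k! b_k/(2k)!`, `b_k = ∫₀^∞ t^{2k}K(t) dt`, satisfies
`E_k(γ) ≥ 0` for every `k ≥ 2` — already `E_2 < 0` for the witness of `exists_admissible_doubleTuran_neg`
(and the sign is the same in full-line moments, `doubleTuran_two_const_mul_pow_mul`). Compare: the same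
hypotheses DO give `T_k > 0` for all `k ≥ 1` (`turanDiff_pos_of_logConcaveSqrt`), and Csordas–Dimitrov's
route to `E_k ≥ 0` (Theorem 2.4, as reported by Csordas) assumes in addition the second-level condition
`(log f)″ < 0`, `f = s′² − ss″`, `s(t) = K(√t)` — established for `Φ` by Planat–Solé.
[cite: Csordas2015, §4, paragraph before Open Problem 4.14, and Open Problem 4.14]
[cite: PlanatSole2026, Theorem 1.1 and §7] -/
theorem not_doubleTuran_of_logConcaveSqrt :
    ¬ ∀ K : ℝ → ℝ, (∀ t, 0 < K t) → (∃ F : ℂ → ℂ, Differentiable ℂ F ∧ ∀ t : ℝ, F t = K t) →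
        (∀ t, K (-t) = K t) → (∀ t, 0 < t → deriv K t < 0) →
        (∃ δ : ℝ, 0 < δ ∧ ∀ n : ℕ, iteratedDeriv n K =O[atTop] fun t => Real.exp (-|t| ^ (2 + δ))) →
        (∀ s, 0 < s → deriv^[2] (fun s => Real.log (K (Real.sqrt s))) s < 0) →
        ∀ k : ℕ, 2 ≤ k → 0 ≤ doubleTuran (kernelTaylorSeq K) k := by
  intro h
  obtain ⟨K, h1, h2, h3, h4, h5, h6, -, -, hE⟩ := exists_admissible_doubleTuran_neg
  have h := h K h1 h2 h3 h4 h5 h6 2 le_rfl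
  linarith

end Literature.Barriers.RiemannHypothesis

end
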